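import Literature.Dynamics.SymbolicDynamics.Hochman2025Frames
import Mathlib.Topology.Order.IntermediateValue
import HarnessLib

/-!
# Hochman 2025, §6: two tools of the gluing argument

Two further proved steps of the printed proof of Thm. 1.1 of M. Hochman, *Irreducibility and
periodicity in `ℤ²` symbolic systems* (Discrete Analysis 2025:17), §6 ("Strong irreducibility"),
continuing `Hochman2025Frames.lean`:

* **§6.1, reduction of the glued region** ("We can assume connected components are
  `½g − 2`-separated", "We can assume that `E, F` are connected"). In the form used with
  `isFinitelyStronglyIrreducible_of_far` (glue `y|_F` into `x` on the WHOLE far region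
  `{u | ∀ q ∈ F, d(u,q) > g}`): it suffices to treat finite sets `F` that are *`g`-chain-connected*
  (any two points of `F` are joined by a chain of points of `F` with consecutive distances `≤ g`).
  Indeed a finite `F` splits into the chain-component `F₁` of one of its points and the rest
  `F₂`, which lie at distance `> g` from each other, so one glues `y|_{F₂}` into `x` first
  (induction on `|F|`) and then `y|_{F₁}` into the result: the second gluing does not touch `F₂`,
  which lies in the far region of `F₁` (`admitsGluing_far_of_chainConnected`,
  `isFinitelyStronglyIrreducible_of_chainConnected`). This replaces the planar-topological
  induction of §6.1 ((B) ⇐ (C) ⇐ (D), components ordered by separation from infinity) by an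
  induction that needs no topology, at the price of gluing into the whole far region.
* **§6.3, "symbol assignment by the coin-and-bucket strategy"** (end of Step A: "we imagine
  witnesses moved one at a time and set `π_{θ(w),σ(w)}(z_{w'})` to `H` or `T` according to the
  strategy in the coin-and-bucket game"). When one witness `u` of a frame is replaced by a witness
  `u'` at a fresh (site, class) slot and the symbol at the new slot is set to the LESS COMMON
  orientation of the destination bucket (the symbols at the other witnesses being unchanged), the
  coin-and-bucket configuration of the frame changes by a legal move of the game of §3
  (`Hochman2025.cbc_move`, `Hochman2025.cbc_move_minority`); hence compatibility
  (unorientability of `CBC`) is preserved (`Hochman2025.isUnorientable_cbc_relocate`), and so it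
  is along any finite sequence of such relocations.
* **§6.3 Step C, choosing a witness on a safe path** ("Since `Ê′` connects the long edges of `Bᵢ`
  we can choose `w ∈ γ ∩ Ê′`"): the graph `γ` of a continuous function meets every preconnected
  plane set containing a point on or below the graph and a point on or above it — the
  intermediate value theorem on the connected set (`Hochman2025.exists_mem_graph_of_isPreconnected`,
  and the rectangle form `Hochman2025.exists_mem_graph_of_crossing`).

## References

* [Hochman2025] M. Hochman, *Irreducibility and periodicity in `ℤ²` symbolic systems*, Discrete
  Analysis 2025:17 — §6.1 (pp. 25–28), §6.3 Step A (pp. 29–31). Read via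
  `lit read arxiv:2401.02273`.
-/

open Finset

namespace Literature.Dynamics.SymbolicDynamics

/-! ### §6.1: reduction to chain-connected glued regions -/

section ChainConnected

variable {A G : Type*} [PseudoMetricSpace G] {X : Set (G → A)} {g : ℝ}

/-- The `g`-chain relation inside a finite set `F` (both points in `F`, at distance `≤ g`) is
symmetric, hence so are its chains. [folklore] -/
private theorem chain_symm (F : Finset G) (g : ℝ) {a b : G}
    (h : Relation.ReflTransGen (fun a b : G => a ∈ F ∧ b ∈ F ∧ dist a b ≤ g) a b) :
    Relation.ReflTransGen (fun a b : G => a ∈ F ∧ b ∈ F ∧ dist a b ≤ g) b a := by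
  induction h with
  | refl => exact Relation.ReflTransGen.refl
  | tail _ hbc ih =>
    exact Relation.ReflTransGen.head ⟨hbc.2.1, hbc.1, by rw [dist_comm]; exact hbc.2.2⟩ ih

/-- A chain from `p₀` inside `F` stays inside the chain-component of `p₀`, so it is also a chain
of the component. [folklore] -/
private theorem chain_restrict [DecidableEq G] (F : Finset G) (g : ℝ) (p₀ : G)
    [DecidablePred fun q => Relation.ReflTransGen (fun a b : G => a ∈ F ∧ b ∈ F ∧ dist a b ≤ g) p₀ q]
    {q : G}
    (hq : Relation.ReflTransGen (fun a b : G => a ∈ F ∧ b ∈ F ∧ dist a b ≤ g) p₀ q) :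
    Relation.ReflTransGen
      (fun a b : G =>
        a ∈ F.filter (fun q => Relation.ReflTransGen (fun a b : G => a ∈ F ∧ b ∈ F ∧ dist a b ≤ g) p₀ q) ∧
        b ∈ F.filter (fun q => Relation.ReflTransGen (fun a b : G => a ∈ F ∧ b ∈ F ∧ dist a b ≤ g) p₀ q) ∧
        dist a b ≤ g) p₀ q := by
  induction hq with
  | refl => exact Relation.ReflTransGen.refl
  | tail hab hbc ih =>
    refine Relation.ReflTransGen.tail ih ⟨?_, ?_, hbc.2.2⟩
    · exact Finset.mem_filter.mpr ⟨hbc.1, hab⟩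
    · exact Finset.mem_filter.mpr ⟨hbc.2.1, hab.tail hbc⟩

/-- **§6.1, finite version without topology.** If `X` admits gluing of `y|_F` into `x` on the
whole far region `{u | ∀ q ∈ F, g < d(u, q)}` for every finite `g`-CHAIN-CONNECTED `F` (any two
points of `F` are joined by a chain in `F` with steps of length `≤ g`), then it does so for every
finite `F`: split off the chain-component `F₁` of a point, glue the rest `F₂` first (induction on
`|F|`), then glue `F₁` into the result — `F₂` lies in the far region of `F₁`, so it is untouched.
(Hochman §6.1 reduces instead to connected, `½g − 2`-separated components by merging close
components and inducting along separation from infinity.) [cite: Hochman2025, §6.1] -/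
theorem admitsGluing_far_of_chainConnected
    (h : ∀ F : Finset G,
      (∀ p ∈ F, ∀ q ∈ F, Relation.ReflTransGen (fun a b : G => a ∈ F ∧ b ∈ F ∧ dist a b ≤ g) p q) →
        AdmitsGluing X {u | ∀ q ∈ F, g < dist u q} (F : Set G))
    (F : Finset G) : AdmitsGluing X {u | ∀ q ∈ F, g < dist u q} (F : Set G) := by
  classical
  induction F using Finset.strongInduction with
  | H F ih =>
    rcases F.eq_empty_or_nonempty with rfl | ⟨p₀, hp₀⟩
    · intro x hx y _
      exact ⟨x, hx, fun _ _ => rfl, fun _ hq => by simp at hq⟩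
    -- the chain-component `F₁` of `p₀` and the rest `F₂`
    set R : G → G → Prop := fun a b => a ∈ F ∧ b ∈ F ∧ dist a b ≤ g with hR
    set F₁ : Finset G := F.filter fun q => Relation.ReflTransGen R p₀ q with hF₁
    set F₂ : Finset G := F \ F₁ with hF₂
    have hF₁F : F₁ ⊆ F := Finset.filter_subset _ _
    have hp₀F₁ : p₀ ∈ F₁ := Finset.mem_filter.mpr ⟨hp₀, Relation.ReflTransGen.refl⟩
    -- `F₂` is at distance `> g` from `F₁`
    have hsep : ∀ q₂ ∈ F₂, ∀ q₁ ∈ F₁, g < dist q₂ q₁ := by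
      intro q₂ hq₂ q₁ hq₁
      obtain ⟨hq₂F, hq₂F₁⟩ := Finset.mem_sdiff.mp hq₂
      by_contra hle
      push Not at hle
      apply hq₂F₁
      have h₁ := (Finset.mem_filter.mp hq₁).2
      exact Finset.mem_filter.mpr ⟨hq₂F, h₁.tail ⟨hF₁F hq₁, hq₂F, by rwa [dist_comm]⟩⟩
    -- `F₁` is chain-connected (inside itself)
    have hF₁conn : ∀ p ∈ F₁, ∀ q ∈ F₁,
        Relation.ReflTransGen (fun a b : G => a ∈ F₁ ∧ b ∈ F₁ ∧ dist a b ≤ g) p q := by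
      have key : ∀ q ∈ F₁,
          Relation.ReflTransGen (fun a b : G => a ∈ F₁ ∧ b ∈ F₁ ∧ dist a b ≤ g) p₀ q := by
        intro q hq
        have := chain_restrict F g p₀ (Finset.mem_filter.mp hq).2
        exact this
      intro p hp q hq
      exact (chain_symm F₁ g (key p hp)).trans (key q hq)
    by_cases hF₂e : F₂ = ∅
    · -- `F = F₁` is chain-connected
      have hFF₁ : F = F₁ := by
        refine Finset.Subset.antisymm (fun q hq => ?_) hF₁F
        by_contra hq₁
        have : q ∈ F₂ := Finset.mem_sdiff.mpr ⟨hq, hq₁⟩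
        rw [hF₂e] at this
        simp at this
      apply h
      rw [hFF₁]
      exact hF₁conn
    · -- glue `F₂` first (it is smaller), then `F₁`
      have hF₂lt : F₂ ⊂ F := by
        refine Finset.ssubset_iff_subset_ne.mpr ⟨Finset.sdiff_subset, fun heq => ?_⟩
        have : p₀ ∈ F₂ := heq ▸ hp₀
        exact (Finset.mem_sdiff.mp this).2 hp₀F₁
      intro x hx y hy
      obtain ⟨z₁, hz₁, hz₁x, hz₁y⟩ := ih F₂ hF₂lt x hx y hy
      obtain ⟨z, hz, hzz₁, hzy⟩ := h F₁ hF₁conn z₁ hz₁ y hy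
      refine ⟨z, hz, fun u hu => ?_, fun q hq => ?_⟩
      · -- far from `F`: far from `F₁` and from `F₂`
        have hu₁ : u ∈ {u | ∀ q ∈ F₁, g < dist u q} := fun q hq => hu q (hF₁F hq)
        have hu₂ : u ∈ {u | ∀ q ∈ F₂, g < dist u q} :=
          fun q hq => hu q (Finset.sdiff_subset hq)
        rw [hzz₁ hu₁, hz₁x hu₂]
      · by_cases hq₁ : q ∈ F₁
        · exact hzy (by exact_mod_cast hq₁)
        · have hq₂ : q ∈ F₂ := Finset.mem_sdiff.mpr ⟨hq, hq₁⟩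
          have hfar : q ∈ {u | ∀ q ∈ F₁, g < dist u q} := fun q₁ hq₁' => hsep q hq₂ q₁ hq₁'
          rw [hzz₁ hfar, hz₁y (by exact_mod_cast hq₂)]

/-- **Corollary.** Gluing into the whole far region along finite `g`-chain-connected sets already
gives strong irreducibility with gap `g` along finite sets.
[cite: Hochman2025, §6.1] -/
theorem isFinitelyStronglyIrreducible_of_chainConnected
    (h : ∀ F : Finset G,
      (∀ p ∈ F, ∀ q ∈ F, Relation.ReflTransGen (fun a b : G => a ∈ F ∧ b ∈ F ∧ dist a b ≤ g) p q) →
        AdmitsGluing X {u | ∀ q ∈ F, g < dist u q} (F : Set G)) :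
    IsFinitelyStronglyIrreducible X g :=
  isFinitelyStronglyIrreducible_of_far (admitsGluing_far_of_chainConnected h)

end ChainConnected

/-! ### §6.3: relocating one witness is a legal move of the coin-and-bucket game -/

namespace Hochman2025

variable {C : Type*}

/-- `CBC` only reads the symbols at the witnesses. [folklore] -/
theorem cbc_congr {n k : ℕ} (e : (ZMod n × ZMod n) × C ≃ Fin k) {x x' : ℤ × ℤ → C → Bool}
    {W : Finset ((ℤ × ℤ) × C)} (h : ∀ w ∈ W, x' w.1 w.2 = x w.1 w.2) :
    cbc e x' W = cbc e x W := by
  simp only [cbc, CoinsAndBuckets.Config.mk.injEq]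
  constructor
  · funext b
    congr 1
    exact Finset.filter_congr fun w hw => by rw [h w hw]
  · funext b
    congr 1
    exact Finset.filter_congr fun w hw => by rw [h w hw]

/-- Adding one witness adds one coin, of orientation its symbol, to its bucket (heads count).
[folklore] -/
theorem cbc_insert_heads [DecidableEq C] {n k : ℕ} (e : (ZMod n × ZMod n) × C ≃ Fin k)
    (x : ℤ × ℤ → C → Bool) {W : Finset ((ℤ × ℤ) × C)} {u : (ℤ × ℤ) × C} (hu : u ∉ W) :
    (cbc e x (insert u W)).heads =
      if x u.1 u.2 = true then
        Function.update (cbc e x W).heads (e (label n u)) ((cbc e x W).heads (e (label n u)) + 1)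
      else (cbc e x W).heads := by
  funext b
  simp only [cbc]
  rw [Finset.filter_insert]
  by_cases hxu : x u.1 u.2 = true
  · simp only [hxu, and_true, if_true]
    by_cases hb : e (label n u) = b
    · subst hb
      simp only [if_true, Function.update_self]
      rw [Finset.card_insert_of_notMem]
      exact fun hmem => hu (Finset.mem_filter.mp hmem).1
    · rw [if_neg hb, Function.update_of_ne (Ne.symm hb)]
  · have hxu' : x u.1 u.2 = false := by simpa using hxu
    simp [hxu']

/-- Adding one witness adds one coin, of orientation its symbol, to its bucket (tails count).
[folklore] -/
theorem cbc_insert_tails [DecidableEq C] {n k : ℕ} (e : (ZMod n × ZMod n) × C ≃ Fin k)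
    (x : ℤ × ℤ → C → Bool) {W : Finset ((ℤ × ℤ) × C)} {u : (ℤ × ℤ) × C} (hu : u ∉ W) :
    (cbc e x (insert u W)).tails =
      if x u.1 u.2 = true then (cbc e x W).tails
      else
        Function.update (cbc e x W).tails (e (label n u))
          ((cbc e x W).tails (e (label n u)) + 1) := by
  funext b
  simp only [cbc]
  rw [Finset.filter_insert]
  by_cases hxu : x u.1 u.2 = true
  · simp [hxu]
  · have hxu' : x u.1 u.2 = false := by simpa using hxu
    simp only [hxu', Bool.false_eq_true, if_false]
    by_cases hb : e (label n u) = b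
    · subst hb
      simp only [true_and, if_true, Function.update_self]
      rw [Finset.card_insert_of_notMem]
      exact fun hmem => hu (Finset.mem_filter.mp hmem).1
    · rw [if_neg (fun h => hb h.1), Function.update_of_ne (Ne.symm hb)]

/-- **Relocating a witness is a legal move (§6.3, Step A, last paragraph).** Let `W` be the other
witnesses of a frame, `u ∉ W` the witness that is moved and `u' ∉ W` its replacement at a fresh
(site, class) slot. If the new configuration `x'` agrees with `x` at the witnesses of `W`, and the
symbol of `x'` at the new slot is a LESS COMMON orientation among the coins of the destination
bucket `([u'] mod n, class)` (counted without the moved coin), then `CBC(x', W ∪ {u'})` is obtained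
from `CBC(x, W ∪ {u})` by one legal move of the coins-and-buckets game: the coin of `u` leaves its
bucket and lands in the bucket of `u'` with the minority orientation.
[cite: Hochman2025, §6.3 Step A (symbol assignment by the coin-and-bucket strategy)] -/
theorem cbc_move [DecidableEq C] {n k : ℕ} (e : (ZMod n × ZMod n) × C ≃ Fin k)
    {x x' : ℤ × ℤ → C → Bool} {W : Finset ((ℤ × ℤ) × C)} {u u' : (ℤ × ℤ) × C}
    (hu : u ∉ W) (hu' : u' ∉ W) (hx : ∀ w ∈ W, x' w.1 w.2 = x w.1 w.2)
    (hH : x' u'.1 u'.2 = true →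
      (cbc e x W).heads (e (label n u')) ≤ (cbc e x W).tails (e (label n u')))
    (hT : x' u'.1 u'.2 = false →
      (cbc e x W).tails (e (label n u')) ≤ (cbc e x W).heads (e (label n u'))) :
    CoinsAndBuckets.Move (cbc e x (insert u W)) (cbc e x' (insert u' W)) := by
  -- express both configurations in terms of `c₀ = CBC(x, W) = CBC(x', W)`
  set c₀ := cbc e x W with hc₀
  set i := e (label n u) with hi
  set j := e (label n u') with hj
  have hsrc : cbc e x (insert u W) = ⟨(cbc e x (insert u W)).heads, (cbc e x (insert u W)).tails⟩ :=
    rfl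
  have htgt : cbc e x' (insert u' W) =
      ⟨(cbc e x' (insert u' W)).heads, (cbc e x' (insert u' W)).tails⟩ := rfl
  have hH' := cbc_insert_heads e x' (W := W) hu'
  have hT' := cbc_insert_tails e x' (W := W) hu'
  rw [cbc_congr e hx] at hH' hT'
  have hHs := cbc_insert_heads e x (W := W) hu
  have hTs := cbc_insert_tails e x (W := W) hu
  rw [htgt, hH', hT', hsrc, hHs, hTs]
  simp only [← hc₀, ← hi, ← hj]
  -- undoing the `+1` at `i`
  have undoH : Function.update (Function.update c₀.heads i (c₀.heads i + 1)) i
      (Function.update c₀.heads i (c₀.heads i + 1) i - 1) = c₀.heads := by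
    rw [Function.update_idem, Function.update_self, Nat.add_sub_cancel, Function.update_eq_self]
  have undoT : Function.update (Function.update c₀.tails i (c₀.tails i + 1)) i
      (Function.update c₀.tails i (c₀.tails i + 1) i - 1) = c₀.tails := by
    rw [Function.update_idem, Function.update_self, Nat.add_sub_cancel, Function.update_eq_self]
  by_cases hxu : x u.1 u.2 = true <;> by_cases hxu' : x' u'.1 u'.2 = true
  · -- heads → heads
    simp only [hxu, hxu', if_true]
    have hpos : 0 < (Function.update c₀.heads i (c₀.heads i + 1)) i := by
      rw [Function.update_self]; exact Nat.succ_pos _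
    have hm := CoinsAndBuckets.Move.headsToHeads
      ⟨Function.update c₀.heads i (c₀.heads i + 1), c₀.tails⟩ i j hpos
        (by rw [undoH]; exact hH hxu')
    rw [undoH] at hm
    exact hm
  · -- heads → tails
    have hxu'f : x' u'.1 u'.2 = false := by simpa using hxu'
    simp only [hxu, hxu'f, if_true, Bool.false_eq_true, if_false]
    have hpos : 0 < (Function.update c₀.heads i (c₀.heads i + 1)) i := by
      rw [Function.update_self]; exact Nat.succ_pos _
    have hm := CoinsAndBuckets.Move.headsToTails
      ⟨Function.update c₀.heads i (c₀.heads i + 1), c₀.tails⟩ i j hpos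
        (by rw [undoH]; exact hT hxu'f)
    rw [undoH] at hm
    exact hm
  · -- tails → heads
    have hxuf : x u.1 u.2 = false := by simpa using hxu
    simp only [hxuf, hxu', if_true, Bool.false_eq_true, if_false]
    have hpos : 0 < (Function.update c₀.tails i (c₀.tails i + 1)) i := by
      rw [Function.update_self]; exact Nat.succ_pos _
    have hm := CoinsAndBuckets.Move.tailsToHeads
      ⟨c₀.heads, Function.update c₀.tails i (c₀.tails i + 1)⟩ i j hpos
        (by rw [undoT]; exact hH hxu')
    rw [undoT] at hm
    exact hm
  · -- tails → tails
    have hxuf : x u.1 u.2 = false := by simpa using hxu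
    have hxu'f : x' u'.1 u'.2 = false := by simpa using hxu'
    simp only [hxuf, hxu'f, Bool.false_eq_true, if_false]
    have hpos : 0 < (Function.update c₀.tails i (c₀.tails i + 1)) i := by
      rw [Function.update_self]; exact Nat.succ_pos _
    have hm := CoinsAndBuckets.Move.tailsToTails
      ⟨c₀.heads, Function.update c₀.tails i (c₀.tails i + 1)⟩ i j hpos
        (by rw [undoT]; exact hT hxu'f)
    rw [undoT] at hm
    exact hm

/-- **The coin strategy.** Choosing at the new slot the symbol "heads iff heads is not the more
common orientation in the destination bucket" satisfies the minority rule of `cbc_move`.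
[cite: Hochman2025, §6.3 Step A] -/
theorem cbc_move_minority [DecidableEq C] {n k : ℕ} (e : (ZMod n × ZMod n) × C ≃ Fin k)
    {x x' : ℤ × ℤ → C → Bool} {W : Finset ((ℤ × ℤ) × C)} {u u' : (ℤ × ℤ) × C}
    (hu : u ∉ W) (hu' : u' ∉ W) (hx : ∀ w ∈ W, x' w.1 w.2 = x w.1 w.2)
    (hmin : x' u'.1 u'.2 =
      decide ((cbc e x W).heads (e (label n u')) ≤ (cbc e x W).tails (e (label n u')))) :
    CoinsAndBuckets.Move (cbc e x (insert u W)) (cbc e x' (insert u' W)) := by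
  refine cbc_move e hu hu' hx (fun h => ?_) (fun h => ?_)
  · rw [hmin] at h
    exact of_decide_eq_true h
  · rw [hmin] at h
    have := of_decide_eq_false h
    omega

/-- **Compatibility survives relocation** (§6.3: "We again define `z` at the sites `w'` above so
as to restore compatibility"): if `CBC(x, W ∪ {u})` is unorientable and the witness `u` is replaced
by `u'` at a fresh slot carrying a minority symbol (other witness symbols unchanged), then
`CBC(x', W ∪ {u'})` is unorientable. [cite: Hochman2025, §6.3 Step A] -/
theorem isUnorientable_cbc_relocate [DecidableEq C] {n k : ℕ} (e : (ZMod n × ZMod n) × C ≃ Fin k)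
    {x x' : ℤ × ℤ → C → Bool} {W : Finset ((ℤ × ℤ) × C)} {u u' : (ℤ × ℤ) × C}
    (hu : u ∉ W) (hu' : u' ∉ W) (hx : ∀ w ∈ W, x' w.1 w.2 = x w.1 w.2)
    (hmin : x' u'.1 u'.2 =
      decide ((cbc e x W).heads (e (label n u')) ≤ (cbc e x W).tails (e (label n u'))))
    (hW : CoinsAndBuckets.IsUnorientable (cbc e x (insert u W))) :
    CoinsAndBuckets.IsUnorientable (cbc e x' (insert u' W)) :=
  hW.move (cbc_move_minority e hu hu' hx hmin)

/-! ### §6.3 Step C: a path across a box meets a connected set joining its long edges -/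

/-- **Crossing lemma** (the step "since `Ê′` connects the long edges of `Bᵢ` we can choose
`w ∈ γ ∩ Ê′`" of §6.3 Step C, for `γ` the graph of a continuous function, which is what
Prop. 4.1 (3) provides): a preconnected set `K ⊆ ℝ²` containing a point on or below the graph of
`f` and a point on or above it meets the graph. (Intermediate value theorem for the continuous
function `u ↦ u.2 - f u.1` on the connected set `K`.) [cite: Hochman2025, §6.3 Step C] -/
theorem exists_mem_graph_of_isPreconnected {f : ℝ → ℝ} (hf : Continuous f) {K : Set (ℝ × ℝ)}
    (hK : IsPreconnected K) {p q : ℝ × ℝ} (hp : p ∈ K) (hq : q ∈ K) (hpf : p.2 ≤ f p.1)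
    (hqf : f q.1 ≤ q.2) : ∃ u ∈ K, u.2 = f u.1 :=
  hK.intermediate_value₂ hp hq continuous_snd.continuousOn (hf.comp continuous_fst).continuousOn
    hpf hqf

/-- **Crossing lemma, rectangle form**: if the graph of the continuous `f` stays inside the
horizontal strip `b ≤ y ≤ t` over the abscissae of `K` (a path "connecting the short edges" of a
box `[l, r] × [b, t]` ⊇ `K`), and the preconnected set `K` contains a point of the bottom edge
(`p.2 = b`) and a point of the top edge (`q.2 = t`) ("`K` connects the long edges"), then `K`
meets the graph. [cite: Hochman2025, §6.3 Step C] -/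
theorem exists_mem_graph_of_crossing {f : ℝ → ℝ} (hf : Continuous f) {b t : ℝ}
    {K : Set (ℝ × ℝ)} (hK : IsPreconnected K) (hfK : ∀ u ∈ K, b ≤ f u.1 ∧ f u.1 ≤ t)
    {p q : ℝ × ℝ} (hp : p ∈ K) (hq : q ∈ K) (hpb : p.2 = b) (hqt : q.2 = t) :
    ∃ u ∈ K, u.2 = f u.1 :=
  exists_mem_graph_of_isPreconnected hf hK hp hq (hpb ▸ (hfK p hp).1) (hqt ▸ (hfK q hq).2)

end Hochman2025

end Literature.Dynamics.SymbolicDynamics
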